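import Summits.RiemannHypothesis.RiemannHypothesis.Theorems.TiltedLandingLaw421R3SuccTheft2
import Summits.RiemannHypothesis.RiemannHypothesis.Theorems.TiltedLandingLaw421R3DimpleSig

/-! # TiltedLandingLaw421 — round 3q SUPPORT: the EXCESS band step (critic (E2)) and the COLLAR / EDGE split of STUB 1 (W-08, C1 rh-idea-5 g27)

SUPPORT module (no stub, no crux, no `sorry`; the two sockets `CollarLawQ C`, `EdgeLawQ C` are OPEN `def`s, typed ≠ proved).
Nothing here bears on the truth of RH; RH is not proved; 24774 OPEN.

§1 (K) THE EXCESS BAND STEP — critic RESULT-21 (E2) in kernel form: a NEAR-MISS step `(Re w − Re v)² + Im w² ≤ Im v² + e` from a level-`j` band state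
`v` lands in band_{j+1} as soon as the excess is paid by the level's margin, `(j+1)·e + 2ρ(v)σ ≤ (Hs² − Im v²) + M_j(v) + j·σ²` (`σ = |Re w − Re v|`,
`ρ(v) = (|Re v − x₀| − R/2)₊`, `M_j(v) = j·Hs² − ρ(v)² − j·Im v²`); `e ≤ 0` is the tree's `band_step'`. State form `stTrkDQ_succ_of_excess`.

§2 (T + K) THE COLLAR / EDGE SPLIT of `AntiEscape` (C3 RESULT-4 (S2)(ii) typed with the tree's near-miss tool `RhW08.SuccTheft.NearMissAt` /
`SlackAt` / `stTrkDQ_succ_of_nearMiss` / `slackAt_of_column` of `…R3SuccTheft2` §8): at the lowest band state `v` of a non-Ready′ level with no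
all-in-band window and no dimple, EITHER some upper zero of `f^{(j+1)}` is NESTED at `v` (successor by the tree's `stTrkDQ_succ_of_nested`), OR `v` is
ROBBED (`Robbed f j v`) and then
* `CollarLawQ C` (OPEN): the robbed lowest state still has NEAR-MISS loot of size `C` (`NearMissAt C f j v`: an upper zero of `f^{(j+1)}` within
  `C·Im v` of `Re v` laterally and of height `≤ C·Im v`) — C6 ADD-126/RIDER-127: the loot sits `0.2–2.4 %` outside the Jensen circle on every robbed
  level of record (r ≤ 1.016 bank 3, ≤ 1.024 overall), g26 WORDS-2 toy: `1.06–1.25·Im v` in dirty clusters;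
* INTERIOR (K): if the collar box stays in the column and under the roof (`|Re v − x₀| + C·Im v ≤ R/2`, `C·Im v ≤ Hs`) the loot is a level-`(j+1)`
  band state (`slackAt_of_column` + `stTrkDQ_succ_of_nearMiss`);
* `EdgeLawQ C` (OPEN, the residual-of-residual = C3's EDGE-STRADDLER / tall state): a robbed lowest state whose collar box pokes out of the column
  (`R/2 < |Re v − x₀| + C·Im v`) or above the roof (`Hs < C·Im v`) still has SOME level-`(j+1)` band state (C6 RIDER-123/124: 7 edge-straddling levels
  on record, successor on 7/7; ADD-128: 0 / 2 895 levels with an empty column under a column lowest state).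
★★★ `antiEscape_of_collar_noSlack : CollarLawQ C → NoSlackLawQ C → AntiEscape` (SHARP residual `NoSlackLawQ C`: robbed lowest state whose collar box
does not fit band_{j+1}, `¬ SlackAt C`), `restSuccBotQ_of_collar_noSlack`; geometric form ★★★ `antiEscape_of_collar_edge (hC : 0 ≤ C) : CollarLawQ C →
EdgeLawQ C → AntiEscape`, `restSuccBotQ_of_collar_edge`, `noSlackLawQ_of_edgeLawQ`; `slackAt_wing_of_margin` (wing states with margin have slack).
NOT the struck pair `NearMissLawQ C ∧ SlackLawQ C` (critic RESULT-19, corner frames): slack is never ASSUMED here — where the box pokes out, the level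
goes to `EdgeLawQ`, and nested loot never needs slack. `C` is a parameter (no hand-picked threshold): the split holds for every `C ≥ 0`; the census picks it. -/

namespace RhW08.CollarQ

open Complex Set
open scoped ComplexConjugate
open Literature.Analysis.Complex
open RhIdea6.G17.W07C7 RhIdea6.G17.W07C7.Rev6 RhIdea6.G18.W07C8.Law421BirthS RhIdea6.G19.W07C11.Seam
open RhIdea6.G20.W07C12.Frac RhIdea6.G20.W07C12.StColP RhW07.C12.FieldSplit RhIdea6.G21.W07C13.TentMax
open RhW07.C14.TwoSided RhW07.C14.Classes RhW07.C14.Lineage RhW07.C14.Booking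
open RhW07.C13.Heredity RhIdea6.G22.W07C15pre.Injection RhW07.E3.Cell RhW07.E3.Lit
open RhW08.Round1 RhW08.StSwap RhW08.Round2 RhW08.QuadW RhW08.SealSwapQ RhW08.SuccB RhW08.SuccSplit RhW08.SuccTheft

/-! ## §1 The EXCESS band step (critic (E2)) -/

/-- ★★ (K) EXCESS BAND STEP: `v` in band_j (`ρ(v)² + j·Im v² ≤ j·Hs²` is implied by the margin hypothesis and not even needed separately), a step
with excess `e` — `(Re w − Re v)² + Im w² ≤ Im v² + e` — and the margin inequality `(j+1)·e + 2·ρ(v)·|Re w − Re v| ≤ (Hs² − Im v²) + (j·Hs² − ρ(v)² −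
j·Im v²) + j·(Re w − Re v)²` ⇒ `w` in band_{j+1}. (For `e ≤ 0` the margin inequality follows from band_j membership: the tree's `band_step'`.) -/
theorem band_step_excess {x₀ R Hs e : ℝ} {j : ℕ} {v w : ℂ}
    (hstep : (w.re - v.re) ^ 2 + w.im ^ 2 ≤ v.im ^ 2 + e)
    (he : ((j : ℝ) + 1) * e + 2 * (max (|v.re - x₀| - R / 2) 0) * |w.re - v.re| ≤
      (Hs ^ 2 - v.im ^ 2) + ((j : ℝ) * Hs ^ 2 - (max (|v.re - x₀| - R / 2) 0) ^ 2 - (j : ℝ) * v.im ^ 2) + (j : ℝ) * (w.re - v.re) ^ 2) :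
    (max (|w.re - x₀| - R / 2) 0) ^ 2 + ((j : ℝ) + 1) * w.im ^ 2 ≤ ((j : ℝ) + 1) * Hs ^ 2 := by
  have hlip : max (|w.re - x₀| - R / 2) 0 ≤ max (|v.re - x₀| - R / 2) 0 + |w.re - v.re| := rho_le_rho_add_abs x₀ R v.re w.re
  have hsq : (max (|w.re - x₀| - R / 2) 0) ^ 2 ≤ (max (|v.re - x₀| - R / 2) 0 + |w.re - v.re|) ^ 2 :=
    pow_le_pow_left₀ (rho_nonneg x₀ R w.re) hlip 2
  have habs : |w.re - v.re| ^ 2 = (w.re - v.re) ^ 2 := sq_abs _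
  have hj : (0 : ℝ) ≤ (j : ℝ) + 1 := by positivity
  have hw2 : ((j : ℝ) + 1) * w.im ^ 2 ≤ ((j : ℝ) + 1) * (v.im ^ 2 + e - (w.re - v.re) ^ 2) :=
    mul_le_mul_of_nonneg_left (by linarith) hj
  nlinarith [hsq, habs, hw2, he]

/-- (K) height from band membership at a level `≥ 1`: `ρ² + (j+1)·Im w² ≤ (j+1)·Hs²`, `0 < Im w`, `0 ≤ Hs` ⇒ `Im w ≤ Hs`. -/
theorem im_le_of_band_succ {x₀ R Hs : ℝ} {j : ℕ} {w : ℂ} (hHs : 0 ≤ Hs) (hw : 0 < w.im)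
    (hb : (max (|w.re - x₀| - R / 2) 0) ^ 2 + ((j : ℝ) + 1) * w.im ^ 2 ≤ ((j : ℝ) + 1) * Hs ^ 2) : w.im ≤ Hs := by
  have hρ : 0 ≤ (max (|w.re - x₀| - R / 2) 0) ^ 2 := sq_nonneg _
  have hj : (0 : ℝ) < (j : ℝ) + 1 := by positivity
  have h2 : w.im ^ 2 ≤ Hs ^ 2 := by
    by_contra h
    push Not at h
    nlinarith [mul_lt_mul_of_pos_left h hj]
  nlinarith [sq_nonneg (w.im - Hs), sq_nonneg (w.im + Hs)]

/-- ★★ (K) STATE FORM of the excess step: a level-`j` band state `v`, an upper zero `w` of `f^{(j+1)}` reached with excess `e` paid by the margin ⇒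
`StTrkDQ … (j+1) w`. (`e ≤ 0`: the tree's `stTrkDQ_succ_of_nested`.) -/
theorem stTrkDQ_succ_of_excess {η : ℝ} {f : ℂ → ℂ} {x₀ s hmax R Hs e : ℝ} {B j : ℕ} {v w : ℂ}
    (hE : EngineHyps5 2 η f x₀ s hmax R Hs B) (hv : StTrkDQ η f x₀ s hmax R Hs B j v)
    (hw0 : iteratedDeriv (j + 1) f w = 0) (hwim : 0 < w.im)
    (hstep : (w.re - v.re) ^ 2 + w.im ^ 2 ≤ v.im ^ 2 + e)
    (he : ((j : ℝ) + 1) * e + 2 * (max (|v.re - x₀| - R / 2) 0) * |w.re - v.re| ≤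
      (Hs ^ 2 - v.im ^ 2) + ((j : ℝ) * Hs ^ 2 - (max (|v.re - x₀| - R / 2) 0) ^ 2 - (j : ℝ) * v.im ^ 2) + (j : ℝ) * (w.re - v.re) ^ 2) :
    StTrkDQ η f x₀ s hmax R Hs B (j + 1) w := by
  have hfnz : iteratedDeriv (j + 1) f ≠ 0 := iteratedDeriv_succ_ne_zero_of_zero hE.1 j hv.1 hv.2.1
  have hband := band_step_excess (x₀ := x₀) (R := R) (Hs := Hs) hstep he
  have hHs : 0 ≤ Hs := hE.2.2.2.2.2.2.2.1
  refine ⟨hfnz, hw0, hwim, ?_, im_le_of_band_succ hHs hwim hband⟩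
  push_cast
  exact hband

/-! ## §2 The COLLAR / EDGE split of `AntiEscape` -/

/-- ROBBED: the level-`j` zero `v` hosts NO nested upper zero of `f^{(j+1)}` (every upper critical point above the axis lies outside its closed Jensen disc). -/
def Robbed (f : ℂ → ℂ) (j : ℕ) (v : ℂ) : Prop :=
  ∀ w : ℂ, iteratedDeriv (j + 1) f w = 0 → 0 < w.im → ¬ NestedStep v w

/-- ★ COLLAR LAW of size `C` (OPEN socket): on a legal frame, the lowest band state `v` of a non-Ready′ level with no all-in-band in-range window and
no dimple, if ROBBED, still has near-miss loot of size `C` — an upper zero `w` of `f^{(j+1)}` with `|Re w − Re v| ≤ C·Im v` and `Im w ≤ C·Im v`. -/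
def CollarLawQ (C : ℝ) : Prop :=
  ∀ (η : ℝ) (f : ℂ → ℂ) (x₀ s hmax R Hs : ℝ) (B : ℕ), EngineHyps5 2 η f x₀ s hmax R Hs B → ∀ (j : ℕ) (v : ℂ),
    IsLowest StTrkDQ η f x₀ s hmax R Hs B j v → ¬ ReadyR2 η f x₀ s hmax R Hs B j v →
    ¬ AllInBandInRangeWindow f x₀ R Hs j v → ¬ Dimple f j v → Robbed f j v → NearMissAt C f j v

/-- ★ EDGE LAW of size `C` (OPEN socket, the residual-of-residual): the same robbed lowest state, when its collar box pokes out of the column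
(`R/2 < |Re v − x₀| + C·Im v`) or above the roof (`Hs < C·Im v`), still sees SOME level-`(j+1)` band state. -/
def EdgeLawQ (C : ℝ) : Prop :=
  ∀ (η : ℝ) (f : ℂ → ℂ) (x₀ s hmax R Hs : ℝ) (B : ℕ), EngineHyps5 2 η f x₀ s hmax R Hs B → ∀ (j : ℕ) (v : ℂ),
    IsLowest StTrkDQ η f x₀ s hmax R Hs B j v → ¬ ReadyR2 η f x₀ s hmax R Hs B j v →
    ¬ AllInBandInRangeWindow f x₀ R Hs j v → ¬ Dimple f j v → Robbed f j v →
    (R / 2 < |v.re - x₀| + C * v.im ∨ Hs < C * v.im) →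
    ∃ u : ℂ, StTrkDQ η f x₀ s hmax R Hs B (j + 1) u

/-- (K) an UN-robbed band state has a successor (the tree's exact nesting step). -/
theorem exists_succ_of_not_robbed {η : ℝ} {f : ℂ → ℂ} {x₀ s hmax R Hs : ℝ} {B j : ℕ} {v : ℂ}
    (hE : EngineHyps5 2 η f x₀ s hmax R Hs B) (hv : StTrkDQ η f x₀ s hmax R Hs B j v) (hnr : ¬ Robbed f j v) :
    ∃ u : ℂ, StTrkDQ η f x₀ s hmax R Hs B (j + 1) u := by
  unfold Robbed at hnr
  push Not at hnr
  obtain ⟨w, hw0, hwim, hn⟩ := hnr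
  exact ⟨w, stTrkDQ_succ_of_nested hE hv hw0 hwim hn⟩

/-- (K) INTERIOR: near-miss loot of size `C ≥ 0` at a band state whose collar box stays in the column and under the roof is a successor. -/
theorem exists_succ_of_nearMiss_interior {η : ℝ} {f : ℂ → ℂ} {x₀ s hmax R Hs C : ℝ} {B j : ℕ} {v : ℂ}
    (hE : EngineHyps5 2 η f x₀ s hmax R Hs B) (hv : StTrkDQ η f x₀ s hmax R Hs B j v) (hC : 0 ≤ C)
    (hcol : |v.re - x₀| + C * v.im ≤ R / 2) (hroof : C * v.im ≤ Hs) (hN : NearMissAt C f j v) :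
    ∃ u : ℂ, StTrkDQ η f x₀ s hmax R Hs B (j + 1) u := by
  obtain ⟨w, hw0, hwim, hre, him⟩ := hN
  have hC0 : 0 ≤ C * v.im := mul_nonneg hC hv.2.2.1.le
  exact ⟨w, stTrkDQ_succ_of_nearMiss hE hv hw0 hwim hre him (slackAt_of_column j hcol hC0 hroof)⟩

/-- ★ NO-SLACK LAW of size `C` (OPEN socket; the SHARP residual): the same robbed lowest state, when its collar box does NOT fit band_{j+1}
(`¬ SlackAt C x₀ R Hs j v` — the box pokes out of the column near the edge, or out of the band near its boundary in the wing, or above the roof),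
still sees SOME level-`(j+1)` band state. `EdgeLawQ C → NoSlackLawQ C` for `C ≥ 0` (`noSlackLawQ_of_edgeLawQ`, contrapositive of `slackAt_of_column`). -/
def NoSlackLawQ (C : ℝ) : Prop :=
  ∀ (η : ℝ) (f : ℂ → ℂ) (x₀ s hmax R Hs : ℝ) (B : ℕ), EngineHyps5 2 η f x₀ s hmax R Hs B → ∀ (j : ℕ) (v : ℂ),
    IsLowest StTrkDQ η f x₀ s hmax R Hs B j v → ¬ ReadyR2 η f x₀ s hmax R Hs B j v →
    ¬ AllInBandInRangeWindow f x₀ R Hs j v → ¬ Dimple f j v → Robbed f j v → ¬ SlackAt C x₀ R Hs j v →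
    ∃ u : ℂ, StTrkDQ η f x₀ s hmax R Hs B (j + 1) u

/-- (K) the geometric edge law implies the sharp no-slack law (`C ≥ 0`). -/
theorem noSlackLawQ_of_edgeLawQ {C : ℝ} (hC : 0 ≤ C) (h : EdgeLawQ C) : NoSlackLawQ C := by
  intro η f x₀ s hmax R Hs B hE j v hlow hnr hnw hnd hrob hns
  refine h η f x₀ s hmax R Hs B hE j v hlow hnr hnw hnd hrob ?_
  by_contra hcon
  push Not at hcon
  exact hns (slackAt_of_column j hcon.1 (mul_nonneg hC hlow.1.2.2.1.le) hcon.2)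

/-- ★★★ (K) THE SHARP SPLIT: `CollarLawQ C → NoSlackLawQ C → AntiEscape` (every real `C`): un-robbed ⇒ nested successor; robbed with slack ⇒ the
near-miss loot is a successor (`stTrkDQ_succ_of_nearMiss`); robbed without slack ⇒ the residual law. -/
theorem antiEscape_of_collar_noSlack {C : ℝ} (h1 : CollarLawQ C) (h2 : NoSlackLawQ C) : AntiEscape := by
  intro η f x₀ s hmax R Hs B hE j v hlow hnr hnw hnd
  by_cases hrob : Robbed f j v
  · by_cases hsl : SlackAt C x₀ R Hs j v
    · obtain ⟨w, hw0, hwim, hre, him⟩ := h1 η f x₀ s hmax R Hs B hE j v hlow hnr hnw hnd hrob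
      exact ⟨w, stTrkDQ_succ_of_nearMiss hE hlow.1 hw0 hwim hre him hsl⟩
    · exact h2 η f x₀ s hmax R Hs B hE j v hlow hnr hnw hnd hrob hsl
  · exact exists_succ_of_not_robbed hE hlow.1 hrob

/-- ★★★ STUB 1 from the collar and no-slack laws. -/
theorem restSuccBotQ_of_collar_noSlack {C : ℝ} (h1 : CollarLawQ C) (h2 : NoSlackLawQ C) : RestSuccBotQ :=
  restSuccBotQ_of_antiEscape (antiEscape_of_collar_noSlack h1 h2)

/-- ★★★ (K) THE GEOMETRIC SPLIT: `CollarLawQ C → EdgeLawQ C → AntiEscape` for every `C ≥ 0`. -/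
theorem antiEscape_of_collar_edge {C : ℝ} (hC : 0 ≤ C) (h1 : CollarLawQ C) (h2 : EdgeLawQ C) : AntiEscape :=
  antiEscape_of_collar_noSlack h1 (noSlackLawQ_of_edgeLawQ hC h2)

/-- ★★★ STUB 1 from the collar and edge laws. -/
theorem restSuccBotQ_of_collar_edge {C : ℝ} (hC : 0 ≤ C) (h1 : CollarLawQ C) (h2 : EdgeLawQ C) : RestSuccBotQ :=
  restSuccBotQ_of_antiEscape (antiEscape_of_collar_edge hC h1 h2)

/-- (K) WING SLACK reading (the tree's `slackAt_of_wing`): a robbed wing state `R/2 ≤ |Re v − x₀|` escapes `NoSlackLawQ C` whenever its own band margin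
pays the collar, `(|Re v − x₀| − R/2 + C·Im v)² + (j+1)(C·Im v)² ≤ (j+1)·Hs²` (and `C·Im v ≤ Hs`). -/
theorem slackAt_wing_of_margin {C x₀ R Hs : ℝ} (j : ℕ) {v : ℂ} (he : R / 2 ≤ |v.re - x₀|) (hC0 : 0 ≤ C * v.im) (hHs : C * v.im ≤ Hs)
    (hineq : (|v.re - x₀| - R / 2 + C * v.im) ^ 2 + ((j : ℝ) + 1) * (C * v.im) ^ 2 ≤ ((j : ℝ) + 1) * Hs ^ 2) : SlackAt C x₀ R Hs j v :=
  slackAt_of_wing j he hC0 hHs hineq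

/-- (K) reading aid: with `C ≤ 1` the roof clause of `EdgeLawQ` is void (`C·Im v ≤ Im v ≤ Hs` for a band state), so the edge law is literally the
EDGE-STRADDLER law. -/
theorem roof_clause_void {η : ℝ} {f : ℂ → ℂ} {x₀ s hmax R Hs C : ℝ} {B j : ℕ} {v : ℂ}
    (hv : StTrkDQ η f x₀ s hmax R Hs B j v) (hC1 : C ≤ 1) : ¬ Hs < C * v.im := by
  have h1 : 0 < v.im := hv.2.2.1
  have h2 : v.im ≤ Hs := hv.2.2.2.2
  push Not
  nlinarith

end RhW08.CollarQ
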